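import Summits.AtomisticToContinuum.Crystallization.Theorems.ChargedEnergyGap.Negative.BlocksBound
import HarnessLib

/-!
# `PeriodicStarCoercivity` (route `ReggeStarCoercivity`, stmt-AtomisticToContinuum-13602), line `pinned-equilibria-reduction`:
stub T2 `stub_deepCount` — almost all lattice coordinates of a block are deep

Registered stub (skeleton rev 5 of the line).  A lattice coordinate `k : Fin 3 → Fin K` of the
`K`-block `[0, K)³` is `d`-deep (`ChargedEnergyGapNegative.Blocks.IsDeep K d k`) when every
coordinate is `≥ d` and `< K − d`.  The landed count `card_not_deep_le K d` bounds the NON-deep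
coordinates by `6 d K²`; since deep and non-deep coordinates together exhaust the `K³` lattice
coordinates (`Finset.card_filter_add_card_filter_not`, `Fintype.card_fun`, `Fintype.card_fin`),
at least `K³ − 6 d K²` coordinates are deep.  This is the lower bound the glue of the line
(`defects_block_ge`) multiplies by the number of defects of the motif.  All `[folklore]`.
-/

noncomputable section

open scoped BigOperators Classical
open Literature.MathematicalPhysics.StatisticalMechanics
open Summit.AtomisticToContinuum.Crystallization.Theorems.ChargedEnergyGapNegative.Blocks

namespace Summit.AtomisticToContinuum.Crystallization.Theorems.ReggeStarCoercivityPeriodicStarCoercivity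

/-- **Stub T2 `stub_deepCount` of the line `pinned-equilibria-reduction`** (crux
`ReggeStarCoercivity.PeriodicStarCoercivity`, stmt-AtomisticToContinuum-13602): at least
`K³ − 6 d K²` of the `K³` lattice coordinates of `[0, K)³` are `d`-deep.  The deep and the
non-deep coordinates partition the `K³` coordinates (`Finset.card_filter_add_card_filter_not`)
and at most `6 d K²` are not deep (`card_not_deep_le`). [folklore] -/
theorem stub_deepCount : ∀ (K d : ℕ),
    (K : ℝ) ^ 3 - 6 * (d : ℝ) * (K : ℝ) ^ 2 ≤ (Nat.card {k : Fin 3 → Fin K // IsDeep K d k} : ℝ) := by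
  intro K d
  have hnd : (Finset.univ.filter fun k : Fin 3 → Fin K => ¬ IsDeep K d k).card ≤ 6 * d * K ^ 2 :=
    card_not_deep_le K d
  have htot : (Finset.univ.filter fun k : Fin 3 → Fin K => IsDeep K d k).card +
      (Finset.univ.filter fun k : Fin 3 → Fin K => ¬ IsDeep K d k).card = K ^ 3 := by
    rw [Finset.card_filter_add_card_filter_not, Finset.card_univ, Fintype.card_fun,
      Fintype.card_fin, Fintype.card_fin]
  have hcard : Nat.card {k : Fin 3 → Fin K // IsDeep K d k} =
      (Finset.univ.filter fun k : Fin 3 → Fin K => IsDeep K d k).card := by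
    rw [Nat.card_eq_fintype_card, Fintype.card_subtype]
  have h1 : ((Finset.univ.filter fun k : Fin 3 → Fin K => IsDeep K d k).card : ℝ) +
      ((Finset.univ.filter fun k : Fin 3 → Fin K => ¬ IsDeep K d k).card : ℝ) = (K : ℝ) ^ 3 := by
    exact_mod_cast htot
  have h2 : ((Finset.univ.filter fun k : Fin 3 → Fin K => ¬ IsDeep K d k).card : ℝ) ≤
      6 * (d : ℝ) * (K : ℝ) ^ 2 := by
    exact_mod_cast hnd
  rw [hcard]
  linarith

end Summit.AtomisticToContinuum.Crystallization.Theorems.ReggeStarCoercivityPeriodicStarCoercivity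

end
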